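import Summits.MatrixMultiplication.OmegaCensus.SmallFormats.HenselLiftObstructionInt
import Summits.MatrixMultiplication.OmegaCensus.SmallFormats.HenselLiftObstruction455
import HarnessLib

/-!
# ω-census family (a): the tree-held `𝔽₂` scheme `⟨4,5,5⟩:73` (Arai–Ichikawa–Hukushima 2024) is congruent mod `2` to no integer scheme

Cell `pub-omega` (unit `pub-omega-tensor`, gen 2), topic `Summits/MatrixMultiplication/OmegaCensus`.  Framing (verbatim):
lottery ticket; floor = certified bounds/negative ranges.  HONEST FRAMING: a one-line corollary about ONE explicit published
object (`SchemeMod2_455.not_liftsToZMod4` + `HenselObstruction.not_intLift_of_not_zmod4Lift`); not progress on `ω`.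
Arai–Ichikawa–Hukushima (ISSAC 2024) obtained rank `73` for `⟨4,5,5⟩` "in characteristic 2"; Perminov (2026) lists
`(4,5,5:73)` as non-liftable.  Here: no integer scheme with `73` products is congruent modulo `2` to the tree-held scheme
`SchemeMod2_455.c1/c2/c3`.  Theorems only.

## References
* Y. Arai, Y. Ichikawa, K. Hukushima, *Adaptive flip graph algorithm for matrix multiplication*, ISSAC 2024, arXiv:2312.16960. [AraiIchikawaHukushima2024]
* M. Kauers, J. Moosbauer, *Flip graphs for matrix multiplication*, ISSAC 2023, arXiv:2212.01175, §5. [KauersMoosbauer2022FlipGraphs]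
-/

namespace Summit.MatrixMultiplication.OmegaCensus

open scoped BigOperators
open Literature.Computability.AlgebraicComplexity
open Literature.Computability.AlgebraicComplexity.MatMulCellCheck

/-- **The tree-held Arai–Ichikawa–Hukushima `𝔽₂` scheme `⟨4,5,5⟩:73` is congruent modulo `2` to no integer scheme with
`73` products** (kernel certificate `SchemeMod2_455.not_liftsToZMod4`). -/
theorem SchemeMod2_455.not_intLift :
    ¬ ∃ (W : Fin 73 → Fin 4 × Fin 5 → ℤ) (U : Fin 73 → Fin 4 × Fin 5 → ℤ) (V : Fin 73 → Fin 5 × Fin 5 → ℤ),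
      (∀ t a, W t a ≡ tz SchemeMod2_455.c1 t.val (a.2.val + 5 * a.1.val) [ZMOD 2]) ∧
      (∀ t b, U t b ≡ tz SchemeMod2_455.c2 t.val (b.2.val + 5 * b.1.val) [ZMOD 2]) ∧
      (∀ t c, V t c ≡ tz SchemeMod2_455.c3 t.val (c.2.val + 5 * c.1.val) [ZMOD 2]) ∧
      matMulTensor ℤ 4 5 5 = ∑ t, triad (W t) (U t) (V t) :=
  HenselObstruction.not_intLift_of_not_zmod4Lift 4 5 5 73 _ _ _ SchemeMod2_455.not_liftsToZMod4

end Summit.MatrixMultiplication.OmegaCensus
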